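import Summits.Ventures.HSemireg.WedgeHankelRecurrenceCommonRoots
import Summits.Ventures.HSemireg.WedgeHankelRecurrenceProductCount

/-!
# Venture HSemireg — THREE HANKEL EXPRESSIONS FOR THE NUMBER OF COMMON ROOTS AGREE (characteristic `0`, statements over `K` itself): for monic `m₁` (degree `t₁ + 1`) and `m₂` (degree `t₂ + 1`),
# the number of distinct common roots is the rank drop `rank H_{t₁}(m₁′/m₁) − rank H_{t₁}(m₂·m₁′/m₁)` (N113 with the weight `m₂`), symmetrically `rank H_{t₂}(m₂′/m₂) − rank H_{t₂}(m₁·m₂′/m₂)`, and the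
# inclusion–exclusion defect `rank H(m₁) + rank H(m₂) − rank H(m₁m₂)` (N121); hence the SPLITTING-FIELD-FREE identities **`rank H(m₁) − rank H_{t₁}(m₂·m₁′/m₁) = rank H(m₂) − rank H_{t₂}(m₁·m₂′/m₂)`**
# and **`rank H(m₁m₂) = rank H_{t₁}(m₂·m₁′/m₁) + rank H(m₂)`** (the distinct roots of `m₁m₂` = the roots of `m₁` off `m₂` plus the roots of `m₂`).

HONEST FRAMING. Part of the Lean index of the computation cell `pub-hsemireg` (seat p10 gen 32, Sunday typer «UNIFORM-IN-n»).
LINEAR ALGEBRA OF HANKEL (catalecticant) MATRICES and of polynomials over a field ONLY (the lineage's `hankelSq (dualSeq …)` ranks): no variety, no cohomology theory, no sheaf, no Ext group and no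
semiregularity map is constructed here; nothing here says that HC / HC_CM / HC_AV holds; no Literature fact is declared or used.  Custodian versions as in `WedgeHankelSiegelIdeal` (1/3).

WHAT IS IN THE TREE.  N113 (`WedgeHankelRecurrenceCommonRoots`): `rank_hankelSq_dualSeq_mul_derivative_add_card_common_of_charZero` (`rank H_t(a·m′/m) + #(Z(φm) ∩ {φa = 0}) = rank H_t(m′/m)`).  N121
(`WedgeHankelRecurrenceProductCount`): `rank_hankelSq_dualSeq_derivative_mul_add_card_inter` (`rank H(m₁m₂) + #(Z(φm₁) ∩ Z(φm₂)) = rank H(m₁) + rank H(m₂)`), `natDegree_mul_eq_of_monic_succ`.  Mathlib: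
`Polynomial.mem_roots`, `SplittingField`.  `rg`: no such identities in the tree.
THIS FILE (namespace `Summit.Ventures.HSemireg.Wedge.HankelOuter` continued; PLAIN on TREE N113 + N121; 0 definitions):
* §704 `filter_isRoot_eq_inter` (`{λ ∈ Z(φm₁) : (φm₂)(λ) = 0} = Z(φm₁) ∩ Z(φm₂)` as finsets), **`rank_hankelSq_weighted_add_card_inter`** (N113 with `a = m₂`, intersection form),
  **`rank_sub_weighted_symm`** (the two rank drops agree), **`rank_hankelSq_mul_eq_weighted_add`** (`rank H(m₁m₂) = rank H_{t₁}(m₂·m₁′/m₁) + rank H(m₂)`), `rank_hankelSq_mul_eq_weighted_add'` (the mirror form).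
Nothing Ext-side.  New names only.
-/

open Module Polynomial
open scoped Matrix Polynomial

namespace Summit.Ventures.HSemireg.Wedge.HankelOuter

open Summit.Ventures.HSemireg.Wedge Summit.Ventures.HSemireg.Wedge.Hankel

variable (K : Type*) [Field K]

/-! ## §704. Characteristic `0`: the three common-root counts agree -/

/-- `{λ ∈ Z(f₁) : f₂(λ) = 0} = Z(f₁) ∩ Z(f₂)` (finsets of distinct roots; `f₂ ≠ 0`). -/
theorem filter_isRoot_eq_inter {L : Type*} [Field L] [DecidableEq L] (f₁ : L[X]) {f₂ : L[X]} (h₂ : f₂ ≠ 0) :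
    (f₁.roots.toFinset.filter fun c => f₂.IsRoot c) = f₁.roots.toFinset ∩ f₂.roots.toFinset := by
  ext c
  rw [Finset.mem_filter, Finset.mem_inter, Multiset.mem_toFinset, Multiset.mem_toFinset, Polynomial.mem_roots h₂]

/-- **N113 with the weight `a = m₂`: `rank H_{t₁}(m₂·m₁′/m₁) + #(Z(φm₁) ∩ Z(φm₂)) = rank H_{t₁}(m₁′/m₁)`** (characteristic `0`, `φ` splitting `m₁`; `m₂ ≠ 0`). -/
theorem rank_hankelSq_weighted_add_card_inter [DecidableEq K] {L : Type*} [Field L] [DecidableEq L] [CharZero L] (φ : K →+* L) {t₁ : ℕ} {m₁ : K[X]} (hm₁ : m₁.Monic) (hd₁ : m₁.natDegree = t₁ + 1)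
    (hs₁ : (m₁.map φ).Splits) {m₂ : K[X]} (hm₂ : m₂ ≠ 0) :
    (hankelSq K t₁ (dualSeq K m₁ (m₂ * derivative m₁))).rank + ((m₁.map φ).roots.toFinset ∩ (m₂.map φ).roots.toFinset).card = (hankelSq K t₁ (dualSeq K m₁ (derivative m₁))).rank := by
  rw [← filter_isRoot_eq_inter (m₁.map φ) (Polynomial.map_ne_zero hm₂)]
  exact rank_hankelSq_dualSeq_mul_derivative_add_card_common_of_charZero K φ hm₁ hd₁ hs₁ m₂

/-- **THE TWO RANK DROPS AGREE (characteristic `0`, over `K`, no splitting field in the statement):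
`rank H_{t₁}(m₁′/m₁) + rank H_{t₂}(m₁·m₂′/m₂) = rank H_{t₂}(m₂′/m₂) + rank H_{t₁}(m₂·m₁′/m₁)`** — both differences count the distinct common roots of `m₁` and `m₂`. -/
theorem rank_sub_weighted_symm [DecidableEq K] [CharZero K] {t₁ t₂ : ℕ} {m₁ m₂ : K[X]} (hm₁ : m₁.Monic) (hd₁ : m₁.natDegree = t₁ + 1) (hm₂ : m₂.Monic) (hd₂ : m₂.natDegree = t₂ + 1) :
    (hankelSq K t₁ (dualSeq K m₁ (derivative m₁))).rank + (hankelSq K t₂ (dualSeq K m₂ (m₁ * derivative m₂))).rank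
      = (hankelSq K t₂ (dualSeq K m₂ (derivative m₂))).rank + (hankelSq K t₁ (dualSeq K m₁ (m₂ * derivative m₁))).rank := by
  classical
  let L := (m₁ * m₂).SplittingField
  let φ := algebraMap K L
  have hs : ((m₁ * m₂).map φ).Splits := SplittingField.splits (m₁ * m₂)
  rw [Polynomial.map_mul] at hs
  have h0 : m₁.map φ * m₂.map φ ≠ 0 := ((hm₁.map φ).mul (hm₂.map φ)).ne_zero
  have h1 := rank_hankelSq_weighted_add_card_inter K φ hm₁ hd₁ (hs.of_dvd h0 (dvd_mul_right _ _)) hm₂.ne_zero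
  have h2 := rank_hankelSq_weighted_add_card_inter K φ hm₂ hd₂ (hs.of_dvd h0 (dvd_mul_left _ _)) hm₁.ne_zero
  rw [Finset.inter_comm] at h2
  omega

/-- **`rank H(m₁m₂) = rank H_{t₁}(m₂·m₁′/m₁) + rank H_{t₂}(m₂′/m₂)`** (characteristic `0`, over `K`): the distinct roots of the product are the roots of `m₁` at which `m₂` does not vanish, plus the roots of
`m₂` (N121's inclusion–exclusion combined with N113's weighted count). -/
theorem rank_hankelSq_mul_eq_weighted_add [DecidableEq K] [CharZero K] {t₁ t₂ : ℕ} {m₁ m₂ : K[X]} (hm₁ : m₁.Monic) (hd₁ : m₁.natDegree = t₁ + 1) (hm₂ : m₂.Monic) (hd₂ : m₂.natDegree = t₂ + 1) :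
    (hankelSq K (t₁ + t₂ + 1) (dualSeq K (m₁ * m₂) (derivative (m₁ * m₂)))).rank
      = (hankelSq K t₁ (dualSeq K m₁ (m₂ * derivative m₁))).rank + (hankelSq K t₂ (dualSeq K m₂ (derivative m₂))).rank := by
  classical
  let L := (m₁ * m₂).SplittingField
  let φ := algebraMap K L
  have hs : ((m₁ * m₂).map φ).Splits := SplittingField.splits (m₁ * m₂)
  rw [Polynomial.map_mul] at hs
  have h0 : m₁.map φ * m₂.map φ ≠ 0 := ((hm₁.map φ).mul (hm₂.map φ)).ne_zero
  have hs₁ : (m₁.map φ).Splits := hs.of_dvd h0 (dvd_mul_right _ _)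
  have hs₂ : (m₂.map φ).Splits := hs.of_dvd h0 (dvd_mul_left _ _)
  have h1 := rank_hankelSq_weighted_add_card_inter K φ hm₁ hd₁ hs₁ hm₂.ne_zero
  have h2 := rank_hankelSq_dualSeq_derivative_mul_add_card_inter K φ hm₁ hd₁ hm₂ hd₂ hs₁ hs₂
  omega

/-- The mirror form: **`rank H(m₁m₂) = rank H_{t₁}(m₁′/m₁) + rank H_{t₂}(m₁·m₂′/m₂)`** (characteristic `0`). -/
theorem rank_hankelSq_mul_eq_weighted_add' [DecidableEq K] [CharZero K] {t₁ t₂ : ℕ} {m₁ m₂ : K[X]} (hm₁ : m₁.Monic) (hd₁ : m₁.natDegree = t₁ + 1) (hm₂ : m₂.Monic) (hd₂ : m₂.natDegree = t₂ + 1) :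
    (hankelSq K (t₁ + t₂ + 1) (dualSeq K (m₁ * m₂) (derivative (m₁ * m₂)))).rank
      = (hankelSq K t₁ (dualSeq K m₁ (derivative m₁))).rank + (hankelSq K t₂ (dualSeq K m₂ (m₁ * derivative m₂))).rank := by
  have h1 := rank_hankelSq_mul_eq_weighted_add K hm₁ hd₁ hm₂ hd₂
  have h2 := rank_sub_weighted_symm K hm₁ hd₁ hm₂ hd₂
  omega

end Summit.Ventures.HSemireg.Wedge.HankelOuter
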